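import Literature.Algebra.Homology.OrderedCechPairSystemResolutionMemberwise
import Literature.Algebra.Homology.OrderedCechPairSystemColumnCriterion
import HarnessLib

/-!
# The ordered Čech bicomplex of a pair-system vs. the corner complex of a resolution — elementwise form (Stacks 0BEC, 0133)

Layer `Literature/Algebra/Homology` (one packaged isomorphism; 0 named facts, no instance, no notation; pure homological algebra over a
commutative ring `A`). The user-facing form of `Algebra/Homology/OrderedCechPairSystemResolution(Memberwise)` +
`…ColumnCriterion` + `…SystemAugmentExact`. DATA: a pair-system of `A`-modules `P : Finset ι ⥤ Finset κ ⥤ ModuleCat A` (`ι`, `κ`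
finite linearly ordered index sets appear only through their simplices), a cochain complex `Q` of pair-systems in degrees `≥ 0`, and an
augmentation `ε : P ⟶ Q⁰` with `ε ≫ d_Q = 0`. HYPOTHESES, all ELEMENTWISE and each about one member or one system at a time:

* (R) for all non-empty `s`, `t`: `ε s t` is injective, `P s t → Q⁰ s t → Q¹ s t` is exact, and `q ↦ Q^q s t` is exact in degrees `≥ 1`
  («`Q• s t` resolves `P s t`»);
* (Cκ) for every `q` and every non-empty `s`: the augmented ordered Čech complex of the `κ`-system `Q^q(s, ·)` —
  `Q^q s ∅ → Č⁰ → Č¹ → ⋯` — is exact («`Q^q(s, ·)` is Čech-acyclic with `Ȟ⁰ = Q^q s ∅`»);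
* (Cι) for every `q`: the same for the `ι`-system `Q^q(·, ∅)` with empty member `Q^q ∅ ∅`.

CONCLUSION: **`homologyIsoEmptyComplexOfSystems … n : Hⁿ(Tot Č•,•(P)) ≅ Hⁿ(q ↦ Q^q ∅ ∅)`** for every `n` — the total complex of the
ordered Čech bicomplex `Č•,•(P)` (`Algebra/Homology/OrderedCechPairSystem`) and the corner complex `emptyComplex Q`
(`Algebra/Homology/OrderedCechPairSystemComplex`) have canonically isomorphic cohomology (the zig-zag of
`OrderedCechPairSystemResolution.homologyIsoEmptyComplex`). The motivating instance (The Stacks Project, Tag 0BEC, proof of the Künneth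
formula: a double Čech complex on two open covers) is NOT treated here; this file is about abstract pair-systems only. Library only
(cell `pub-hodge-ring2`, count-neutral); proves nothing about any crux, route or conjecture.

## References

* The Stacks Project, Tag 0BEC (Künneth: the double Čech complex), Tag 0133 (resolutions and double complexes), Tag 01FG. [StacksProject]
* C. A. Weibel, *An introduction to homological algebra* (1994), 2.7.3, 5.6.1–5.6.2. [Weibel1994]
* U. Görtz, T. Wedhorn, *Algebraic Geometry II* (2023), Lemma 21.65, Def. 21.68, Lemma 21.75 (pp. 179–180, 264). [GortzWedhorn2023]
-/

universe u

open CategoryTheory CategoryTheory.Limits HomologicalComplex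

set_option backward.isDefEq.respectTransparency false

noncomputable section

namespace Literature.Algebra.Homology

namespace OrderedCech

variable {A : Type u} [CommRing A] {ι κ : Type} [LinearOrder ι] [LinearOrder κ]
  {P : Finset ι ⥤ Finset κ ⥤ ModuleCat.{u} A} {Q : CochainComplex (Finset ι ⥤ Finset κ ⥤ ModuleCat.{u} A) ℤ}
  (ε : P ⟶ Q.X 0) (hε : ε ≫ Q.d 0 1 = 0)

/-- **`Hⁿ(Tot Č•,•(P)) ≅ Hⁿ(q ↦ Q^q ∅ ∅)`, elementwise form.** For a resolution datum `ε : P ⟶ Q⁰` of pair-systems of `A`-modules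
(`Q` in degrees `≥ 0`, `ε ≫ d_Q = 0`) such that (R) every member `Q• s t` (`s`, `t` non-empty) resolves `P s t`, (Cκ) every
`κ`-system `Q^q(s, ·)` (`s` non-empty) has exact augmented ordered Čech complex, and (Cι) so does every `ι`-system `Q^q(·, ∅)` — all
elementwise — the cohomology of the total complex of the ordered Čech bicomplex of `P` is canonically that of the corner complex
`q ↦ Q^q ∅ ∅` (`homologyIsoEmptyComplexOfMemberwise` with (H2col) by `quasiIso_sysAugmentHom_cochainSystem_of_memberwise` and (H2∅) by
`quasiIso_sysAugmentHom_of_exact`). [cite: StacksProject, Tag 0BEC] [cite: StacksProject, Tag 0133] [cite: Weibel1994, 2.7.3] -/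
def homologyIsoEmptyComplexOfSystems [Q.IsStrictlyGE 0]
    -- (R) member-wise resolutions on non-empty pairs
    (hinj : ∀ (s : Finset ι) (t : Finset κ), s.Nonempty → t.Nonempty → Function.Injective ((ε.app s).app t).hom)
    (hex₀ : ∀ (s : Finset ι) (t : Finset κ), s.Nonempty → t.Nonempty → ∀ x : ((Q.X 0).obj s).obj t,
      (((Q.d 0 1).app s).app t).hom x = 0 → ∃ y : (P.obj s).obj t, ((ε.app s).app t).hom y = x)
    (hex : ∀ q : ℤ, 1 ≤ q → ∀ (s : Finset ι) (t : Finset κ), s.Nonempty → t.Nonempty → ∀ x : ((Q.X q).obj s).obj t,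
      (((Q.d q (q + 1)).app s).app t).hom x = 0 →
        ∃ y : ((Q.X (q - 1)).obj s).obj t, (((Q.d (q - 1) q).app s).app t).hom y = x)
    -- (Cκ) the `κ`-systems `Q^q(s, ·)`, `s` non-empty, have exact augmented ordered Čech complexes
    (hκinj : ∀ (q : ℤ) (s : Finset ι), s.Nonempty → Function.Injective (sysAugment ((Q.X q).obj s)))
    (hκ₀ : ∀ (q : ℤ) (s : Finset ι), s.Nonempty → ∀ x : SysCochain ((Q.X q).obj s) 0, sysD ((Q.X q).obj s) 0 x = 0 →
      ∃ g : ((Q.X q).obj s).obj ∅, sysAugment ((Q.X q).obj s) g = x)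
    (hκ : ∀ (q : ℤ) (s : Finset ι), s.Nonempty → ∀ n : ℤ, 1 ≤ n → ∀ x : SysCochain ((Q.X q).obj s) n,
      ((sysComplex ((Q.X q).obj s)).d n (n + 1)).hom x = 0 →
        ∃ y : SysCochain ((Q.X q).obj s) (n - 1), ((sysComplex ((Q.X q).obj s)).d (n - 1) n).hom y = x)
    -- (Cι) the `ι`-systems `Q^q(·, ∅)` have exact augmented ordered Čech complexes
    (hιinj : ∀ q : ℤ, Function.Injective (sysAugment ((Q.X q).flip.obj ∅)))
    (hι₀ : ∀ (q : ℤ) (x : SysCochain ((Q.X q).flip.obj ∅) 0), sysD ((Q.X q).flip.obj ∅) 0 x = 0 →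
      ∃ g : ((Q.X q).flip.obj ∅).obj ∅, sysAugment ((Q.X q).flip.obj ∅) g = x)
    (hι : ∀ (q n : ℤ), 1 ≤ n → ∀ x : SysCochain ((Q.X q).flip.obj ∅) n,
      ((sysComplex ((Q.X q).flip.obj ∅)).d n (n + 1)).hom x = 0 →
        ∃ y : SysCochain ((Q.X q).flip.obj ∅) (n - 1), ((sysComplex ((Q.X q).flip.obj ∅)).d (n - 1) n).hom y = x)
    (n : ℤ) :
    ((sysBicomplex P).total (ComplexShape.up ℤ)).homology n ≅ (emptyComplex Q).homology n :=
  homologyIsoEmptyComplexOfMemberwise ε hε hinj hex₀ hex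
    (fun q a => quasiIso_sysAugmentHom_cochainSystem_of_memberwise (Q.X q) a
      (fun σ => hκinj q σ.1 σ.2.1) (fun σ => hκ₀ q σ.1 σ.2.1) (fun σ => hκ q σ.1 σ.2.1))
    (fun q => quasiIso_sysAugmentHom_of_exact _ (hιinj q) (hι₀ q) (hι q)) n

end OrderedCech

end Literature.Algebra.Homology

end
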